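import Summits.QuantumFields.YangMills.Theorems.UnitScaleTiltProp8HalvingA1Row165TraceAnyW
import Summits.QuantumFields.YangMills.Theorems.UnitScaleTiltProp8FlatPlaqDeriv
import HarnessLib

/-!
# Route `UnitScaleTilt`, crux K1 child «MinimiserStabilityRegPr» (stmt-QuantumFields-19200), registered stub V2′ `stub_halvingStep`
# (skeletons v8 5b4e846794b80374 ∕ v10 `BirthV10`) — **THE (165)-A₁ ROW FROM THE 𝔰𝔲(2) TRACE PAIRING** (owner row M3, the `hcrit` junction — repair (R2) of the
# seat's LOCATED ✗ 2026-08-28: the suppliers of hypothesis (i) of ✓ p603846 can only be instantiated on 𝔰𝔲(2)-VALUED competitor sets, where the test matrices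
# `E` are TRACELESS; this file is ✓ p603846 `row165_of_tracePairing_L5_anyW` with (i) asked ONLY for traceless self-adjoint `E`, for a traceless chart field `A′`)

Cell `ym3-torus` (HUMAN RULING D-0037, YM ladder rung R3 — continuum SU(2) YM₃ on the torus is a RUNG, not the Clay problem), width seat
`ym-ust-19200-w7` gen 0 (D-0154 (3c)).  `--supports stmt-QuantumFields-19200 --as helper`; def-free, 0 sorry, standard axioms.

WHY.  ✓ p603846 `row165_of_tracePairing_L5_anyW` asks (i) «the trace pairing of `(A′, W₀A′)` vanishes on `ker Q` against `s•E` for EVERY self-adjoint `E`»; its suppliers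
(✓ p604227 `tracePairing_of_isMinOn`, ✓ p605698 `tracePairing_of_isMinOn_dressed_wilson`) obtain it by Fermat along `A + t·(s•E)` inside a competitor set `T` through an
`SU(2)`-valued chart `↑(U X) = e^{iηX}` on `T` — which is only possible when `T` is 𝔰𝔲(2)-valued (`det e^{iηX(b)} = e^{iη·tr X(b)}`), i.e. when the tests `E` are TRACELESS
(print's spaces (126)∕(150) are `𝔤 = 𝔰𝔲(2)`-valued: [Balaban1985Variational] p. 297 *«for all δA′ satisfying QδA′ = 0»*, `δA′` 𝔤-valued).  Against traceless self-adjoint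
`E` the pairing sees only the TRACELESS SELF-ADJOINT PART `W♮ := ½(W + Wᴴ) − ¼tr(W + Wᴴ)·1` of the current; `W♮` is bondwise self-adjoint, has the (98) letter of `W` up to
the factor `2` (`‖M − ½(tr M)·1‖ ≤ 2‖M‖` in `M₂(ℂ)`), and for a TRACELESS `A′` the pairing of `(A′, W♮)` against `s•1` vanishes identically (`tr Φ_p(A′) = 0`,
`tr W♮ = 0`) — so (i) for all self-adjoint `E` holds for `W♮`, and ✓ p603252 `row165_of_tracePairing_L5` applies to `W♮`: the THREE (165)-A₁ conjuncts for
`A₁ := A′ − H(QA′)` follow, with the smallness rows `B₀·(4C₄r²) ≤ e`, `(1 + B_M)·(4C₄r²) ≤ e`.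

WHAT THIS FILE PROVES (no definition, no sorry):
* §1 `M₂(ℂ)` ALGEBRA OF THE TRACELESS PART `M − ½(tr M)·1`: `trace_sub_halfTrace`, `isSelfAdjoint_sub_halfTrace`, `norm_sub_halfTrace_le` (`≤ 2‖M‖`),
  `re_trace_sub_halfTrace_mul` (indistinguishable from `M` against traceless `E`), `trace_plaqSum_eq_zero` (`tr Φ_p(A′) = 0` for traceless `A′`),
  `re_trace_mul_smul_sub_halfTrace` (the test `s•E` may be replaced by `s•(E − ½(tr E)·1)` against a traceless matrix).
* §2 ★★ **`row165_of_tracePairing_L5_su2`** — ✓ p603846 with `A′` bondwise traceless and (i) asked only for traceless self-adjoint `E` (smallness `4C₄r²`).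
HONEST SCOPE.  A wrapper over ✓ `row165_of_tracePairing_L5`; the minimiser, the chart, P1∕P2∕P3∕P5 inputs remain hypotheses.  NOT a claim about the stub, the crux, the rung
or the mass gap.

References: T. Bałaban, CMP **102** (1985) 277–309 [Balaban1985Variational] (99)–(100) p.293, (126)–(127) p.297, (152)–(153) p.301, (157)–(158) p.302, (165) p.304.
-/

set_option autoImplicit false

noncomputable section

open scoped BigOperators InnerProductSpace Matrix Matrix.Norms.L2Operator ComplexConjugate

namespace Summit.QuantumFields.YangMills.Theorems.HalvingA1Row165TraceSU2

open Literature.MathematicalPhysics.QuantumFieldTheory.Balaban1983to89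
open B6GlobalChartV1 (PV)
open B6SectADomainsV1 (Domains)
open B6SectAOperatorsV1 (BondIdx QE RE dsE)
open B8Ineq132 (BondTouches)
open B8Eq140Level (SideTouches)
open B8Eq143PlaqExpansion (pdiv)
open B8Eq146AExpansion (plaqCovDeriv)
open B8Thm2SetupTorus (pullDom)
open B10Eq27TorusAxialLog (pull transl)
open LatticeFieldCalculus (bondAvgIter)
open T3ContinuumYM3Torus (T3Family)
open FlatCubeOpsText (IsLevWeight)
open FlatOpsLettersAssembly (flatH)
open FlatCubeSequenceAligned (cubeSeqMT3)
open HalvingA1Row165TraceL5 (row165_of_tracePairing_L5)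
open HalvingA1Row165TraceAnyW (re_trace_antiHerm_mul_selfAdjoint re_trace_mul_eq_hermPart isSelfAdjoint_hermPart norm_hermPart_le)
open FlatPlaqDeriv (norm_trace_le_two_mul)

/-! ## §1 The traceless part in `M₂(ℂ)` -/

section Traceless

/-- `tr(M − ½(tr M)·1) = 0` in `M₂(ℂ)`. [folklore] -/
theorem trace_sub_halfTrace (M : Matrix (Fin 2) (Fin 2) ℂ) :
    Matrix.trace (M - (Matrix.trace M / 2) • (1 : Matrix (Fin 2) (Fin 2) ℂ)) = 0 := by
  rw [Matrix.trace_sub, Matrix.trace_smul, Matrix.trace_one, Fintype.card_fin, smul_eq_mul]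
  push_cast
  ring

/-- the traceless part of a self-adjoint matrix is self-adjoint (`tr M` is real). [folklore] -/
theorem isSelfAdjoint_sub_halfTrace {M : Matrix (Fin 2) (Fin 2) ℂ} (hM : IsSelfAdjoint M) :
    IsSelfAdjoint (M - (Matrix.trace M / 2) • (1 : Matrix (Fin 2) (Fin 2) ℂ)) := by
  refine hM.sub (IsSelfAdjoint.smul ?_ (IsSelfAdjoint.one _))
  have htr : IsSelfAdjoint (Matrix.trace M) := by
    show star (Matrix.trace M) = Matrix.trace M
    rw [← Matrix.trace_conjTranspose, ← Matrix.star_eq_conjTranspose, hM.star_eq]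
  exact IsSelfAdjoint.div htr (IsSelfAdjoint.ofNat 2)

/-- `‖M − ½(tr M)·1‖ ≤ 2‖M‖` in `M₂(ℂ)` (`|tr M| ≤ 2‖M‖`, `‖1‖ = 1`). [folklore] -/
theorem norm_sub_halfTrace_le (M : Matrix (Fin 2) (Fin 2) ℂ) :
    ‖M - (Matrix.trace M / 2) • (1 : Matrix (Fin 2) (Fin 2) ℂ)‖ ≤ 2 * ‖M‖ := by
  have h1 : ‖(Matrix.trace M / 2) • (1 : Matrix (Fin 2) (Fin 2) ℂ)‖ ≤ ‖M‖ := by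
    rw [norm_smul, norm_one, mul_one, norm_div, Complex.norm_ofNat]
    have := norm_trace_le_two_mul M
    linarith
  calc ‖M - (Matrix.trace M / 2) • (1 : Matrix (Fin 2) (Fin 2) ℂ)‖ ≤ ‖M‖ + ‖(Matrix.trace M / 2) • (1 : Matrix (Fin 2) (Fin 2) ℂ)‖ := norm_sub_le _ _
    _ ≤ 2 * ‖M‖ := by linarith

/-- **AGAINST A TRACELESS TEST THE TRACELESS PART IS INDISTINGUISHABLE**: `Re tr((M − ½(tr M)·1)·(tE)) = Re tr(M·(tE))` when `tr E = 0`. [cite: Balaban1985Variational, (99)-(100) p.293] -/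
theorem re_trace_sub_halfTrace_mul (M E : Matrix (Fin 2) (Fin 2) ℂ) (hE : Matrix.trace E = 0) (t : ℝ) :
    (Matrix.trace ((M - (Matrix.trace M / 2) • (1 : Matrix (Fin 2) (Fin 2) ℂ)) * ((t : ℂ) • E))).re = (Matrix.trace (M * ((t : ℂ) • E))).re := by
  rw [Matrix.sub_mul, Matrix.trace_sub, Matrix.smul_mul, Matrix.one_mul, Matrix.trace_smul, Matrix.trace_smul, hE, smul_zero, smul_zero, sub_zero]

/-- `tr(M·(t·(c·1))) = t·c·tr M`; in particular it vanishes for traceless `M`. [folklore] -/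
theorem trace_mul_smul_smul_one_eq_zero {M : Matrix (Fin 2) (Fin 2) ℂ} (hM : Matrix.trace M = 0) (t c : ℂ) :
    Matrix.trace (M * (t • (c • (1 : Matrix (Fin 2) (Fin 2) ℂ)))) = 0 := by
  rw [Matrix.mul_smul, Matrix.mul_smul, Matrix.mul_one, Matrix.trace_smul, Matrix.trace_smul, hM, smul_zero, smul_zero]

end Traceless

/-! ## §2 The (165)-A₁ row from the 𝔰𝔲(2) trace pairing -/

section Carrier

/-- `1 ≤ 3` (named once). [folklore] -/
private theorem hd3 : 1 ≤ 2 + 1 := by norm_num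

/-- ★★ **THE (165)-A₁ ROW FROM THE 𝔰𝔲(2) TRACE PAIRING, EVERY ODD `L ≥ 5`** — ✓ `HalvingA1Row165TraceAnyW.row165_of_tracePairing_L5_anyW` with the chart field `A′`
bondwise TRACELESS and hypothesis (i) asked ONLY for traceless self-adjoint test matrices `E` (the tests an `SU(2)`-valued chart admits), smallness rows with `4C₄r²`; the
three (165)-A₁ conjuncts VERBATIM for `A₁ := A′ − H(QA′)`. [cite: Balaban1985Variational, (99)-(100) p.293, (126)-(127) p.297, (152)-(153) p.301, (158) p.302, (165) p.304] -/
theorem row165_of_tracePairing_L5_su2 (ℓ : ℕ) (hL : Odd (ℓ + 1) ∧ 1 < ℓ + 1) (hℓ : 4 ≤ ℓ) :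
    ∃ (Mh₀ R₀ : ℕ) (B₀ BM : ℝ), 0 ≤ B₀ ∧ 0 ≤ BM ∧
    ∀ (m : ℕ) (hm : 1 ≤ m) (n K : ℕ) (_ : 1 ≤ K - n) (_ : K - n + 1 ≤ m + K) {Mh R a' : ℕ} (_ : Mh = (ℓ + 1) ^ a') (_ : Mh₀ ≤ Mh) (_ : R₀ ≤ R)
      (_ : a' + 3 ≤ m + n) (hM1 : 1 ≤ (ℓ + 1) * Mh) (x₀ : Site (PV 2 ℓ m K hd3 hL) 0) (ρ S : ℕ) (_ : R * ((ℓ + 1) * Mh) ≤ S) (_ : 1 ≤ ρ)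
      (w : ℕ → PBond (PV 2 ℓ m K hd3 hL) 0 → ℝ)
      (_ : IsLevWeight (⟨ℓ + 1, hL, m, hm⟩ : T3Family) n K (cubeSeqMT3 (⟨ℓ + 1, hL, m, hm⟩ : T3Family) n K x₀ ρ S ((ℓ + 1) * Mh) hM1) w)
      (A' : PBond (PV 2 ℓ m K hd3 hL) 0 → Matrix (Fin 2) (Fin 2) ℂ) (_ : ∀ b, IsSelfAdjoint (A' b)) (_ : ∀ b, Matrix.trace (A' b) = 0)
      (W₀ : (PBond (PV 2 ℓ m K hd3 hL) 0 → Matrix (Fin 2) (Fin 2) ℂ) → (PBond (PV 2 ℓ m K hd3 hL) 0 → Matrix (Fin 2) (Fin 2) ℂ)) {C₄ a₃ r e : ℝ}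
      (_ : ∀ (Y : PBond (PV 2 ℓ m K hd3 hL) 0 → Matrix (Fin 2) (Fin 2) ℂ) (r' : ℝ), r' < a₃ → (∀ b, w 1 b * ‖Y b‖ ≤ r') →
        (∀ (b : PBond (PV 2 ℓ m K hd3 hL) 0) (ν : Fin 3), w 2 b * (((ℓ + 1 : ℕ) : ℝ)) ^ (K - n) * ‖Y ⟨b.src.shift ν, b.dir⟩ - Y b‖ ≤ r') →
        ∀ b, w 3 b * ‖W₀ Y b‖ ≤ C₄ * r' ^ 2)
      (_ : ∀ s : PBond (PV 2 ℓ m K hd3 hL) 0 → ℝ, QE (cubeSeqMT3 (⟨ℓ + 1, hL, m, hm⟩ : T3Family) n K x₀ ρ S ((ℓ + 1) * Mh) hM1) (WithLp.toLp 2 s) = 0 →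
        ∀ E : Matrix (Fin 2) (Fin 2) ℂ, IsSelfAdjoint E → Matrix.trace E = 0 →
        (((((((ℓ + 1 : ℕ) : ℝ)⁻¹) ^ (K - n) : ℝ) : ℂ) ^ 2 / 2) *
            ∑ p : Plaq (PV 2 ℓ m K hd3 hL) 0, Matrix.trace ((A' ⟨p.src, p.μ⟩ + A' ⟨p.src.shift p.μ, p.ν⟩ - A' ⟨p.src.shift p.ν, p.μ⟩ - A' ⟨p.src, p.ν⟩) *
              (((s ⟨p.src, p.μ⟩ : ℝ) : ℂ) • E + ((s ⟨p.src.shift p.μ, p.ν⟩ : ℝ) : ℂ) • E - ((s ⟨p.src.shift p.ν, p.μ⟩ : ℝ) : ℂ) • E -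
                ((s ⟨p.src, p.ν⟩ : ℝ) : ℂ) • E)) +
          (((((ℓ + 1 : ℕ) : ℝ)⁻¹) ^ (K - n) : ℝ) : ℂ) ^ 4 * ∑ b : PBond (PV 2 ℓ m K hd3 hL) 0, Matrix.trace (W₀ A' b * (((s b : ℝ) : ℂ) • E))).re = 0)
      (_ : ∀ φ : Matrix (Fin 2) (Fin 2) ℂ →ₗ[ℝ] ℝ,
        RE (cubeSeqMT3 (⟨ℓ + 1, hL, m, hm⟩ : T3Family) n K x₀ ρ S ((ℓ + 1) * Mh) hM1) ((((ℓ + 1 : ℕ) : ℝ)) ^ (K - n))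
          (dsE ((((ℓ + 1 : ℕ) : ℝ)) ^ (K - n)) (WithLp.toLp 2 (fun b => φ (A' b)))) = 0)
      (_ : r < a₃) (_ : ∀ b, w 1 b * ‖A' b‖ ≤ r)
      (_ : ∀ (b : PBond (PV 2 ℓ m K hd3 hL) 0) (ν : Fin 3), w 2 b * (((ℓ + 1 : ℕ) : ℝ)) ^ (K - n) * ‖A' ⟨b.src.shift ν, b.dir⟩ - A' b‖ ≤ r)
      (_ : B₀ * (4 * C₄ * r ^ 2) ≤ e) (_ : (1 + BM) * (4 * C₄ * r ^ 2) ≤ e),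
      (∀ (z : B7Prop1Explicit.Site (PV 2 ℓ m K hd3 hL).d) (τ : Fin (PV 2 ℓ m K hd3 hL).d),
        SideTouches (pullDom (fun j => if K - n ≤ j then ({x₀} : Set (Site (PV 2 ℓ m K hd3 hL) 0)) else (∅ : Set (Site (PV 2 ℓ m K hd3 hL) 0))) (K - n)) z τ →
        ‖(A' - fun b : PBond (PV 2 ℓ m K hd3 hL) 0 => ∑ c, flatH (⟨ℓ + 1, hL, m, hm⟩ : T3Family) n K (cubeSeqMT3 (⟨ℓ + 1, hL, m, hm⟩ : T3Family) n K x₀ ρ S ((ℓ + 1) * Mh) hM1) (Pi.single c 1) b •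
            bondAvgIter (c.1.1 : ℕ) A' c.1.2) ⟨transl 0 z, τ⟩‖ ≤ e) ∧
      (∀ (z : B7Prop1Explicit.Site (PV 2 ℓ m K hd3 hL).d) (κ τ : Fin (PV 2 ℓ m K hd3 hL).d),
        SideTouches (pullDom (fun j => if K - n ≤ j then ({x₀} : Set (Site (PV 2 ℓ m K hd3 hL) 0)) else (∅ : Set (Site (PV 2 ℓ m K hd3 hL) 0))) (K - n)) z τ →
        ‖(((((ℓ + 1 : ℕ) : ℝ))⁻¹) ^ (K - n))⁻¹ •
          ((A' - fun b : PBond (PV 2 ℓ m K hd3 hL) 0 => ∑ c, flatH (⟨ℓ + 1, hL, m, hm⟩ : T3Family) n K (cubeSeqMT3 (⟨ℓ + 1, hL, m, hm⟩ : T3Family) n K x₀ ρ S ((ℓ + 1) * Mh) hM1) (Pi.single c 1) b •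
              bondAvgIter (c.1.1 : ℕ) A' c.1.2) ⟨(transl 0 z).shift κ, τ⟩ -
            (A' - fun b : PBond (PV 2 ℓ m K hd3 hL) 0 => ∑ c, flatH (⟨ℓ + 1, hL, m, hm⟩ : T3Family) n K (cubeSeqMT3 (⟨ℓ + 1, hL, m, hm⟩ : T3Family) n K x₀ ρ S ((ℓ + 1) * Mh) hM1) (Pi.single c 1) b •
              bondAvgIter (c.1.1 : ℕ) A' c.1.2) ⟨transl 0 z, τ⟩)‖ ≤ e) ∧
      (∀ (z : B7Prop1Explicit.Site (PV 2 ℓ m K hd3 hL).d) (μ : Fin (PV 2 ℓ m K hd3 hL).d),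
        BondTouches (pullDom (fun j => if K - n ≤ j then ({x₀} : Set (Site (PV 2 ℓ m K hd3 hL) 0)) else (∅ : Set (Site (PV 2 ℓ m K hd3 hL) 0))) (K - n)) z μ →
        ‖pdiv (((((ℓ + 1 : ℕ) : ℝ))⁻¹) ^ (K - n)) (1 : B7Prop1Explicit.Site (PV 2 ℓ m K hd3 hL).d → Fin (PV 2 ℓ m K hd3 hL).d → (Matrix (Fin 2) (Fin 2) ℂ)ˣ)
            (plaqCovDeriv (((((ℓ + 1 : ℕ) : ℝ))⁻¹) ^ (K - n))
              (1 : B7Prop1Explicit.Site (PV 2 ℓ m K hd3 hL).d → Fin (PV 2 ℓ m K hd3 hL).d → (Matrix (Fin 2) (Fin 2) ℂ)ˣ)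
              (pull (A' - fun b : PBond (PV 2 ℓ m K hd3 hL) 0 => ∑ c, flatH (⟨ℓ + 1, hL, m, hm⟩ : T3Family) n K (cubeSeqMT3 (⟨ℓ + 1, hL, m, hm⟩ : T3Family) n K x₀ ρ S ((ℓ + 1) * Mh) hM1)
                (Pi.single c 1) b • bondAvgIter (c.1.1 : ℕ) A' c.1.2) 0)) μ z‖ ≤ e) := by
  obtain ⟨Mh₀, R₀, B₀, BM, hB₀, hBM, hmain⟩ := row165_of_tracePairing_L5 ℓ hL hℓ
  refine ⟨Mh₀, R₀, B₀, BM, hB₀, hBM, ?_⟩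
  intro m hm n K hk1 hk' Mh R a' hMha hMh hR hsize hM1 x₀ ρ S hRS hρ1 w hw A' hA' hA'tr W₀ C₄ a₃ r e hWq hpair hslice hr h1 h2 he₁ he₂
  -- the traceless self-adjoint part of the current
  refine hmain m hm n K hk1 hk' hMha hMh hR hsize hM1 x₀ ρ S hRS hρ1 w hw A' hA'
    (fun Y b => (1 / 2 : ℝ) • (W₀ Y b + (W₀ Y b)ᴴ) - (Matrix.trace ((1 / 2 : ℝ) • (W₀ Y b + (W₀ Y b)ᴴ)) / 2) • (1 : Matrix (Fin 2) (Fin 2) ℂ))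
    (fun b => isSelfAdjoint_sub_halfTrace (isSelfAdjoint_hermPart (W₀ A' b))) (C₄ := 2 * C₄)
    (fun Y r' hr' hY1 hY2 b => ?_) (fun s hs E hE => ?_) hslice hr h1 h2 (by linarith) (by linarith)
  · -- (98) for the traceless self-adjoint part: `‖M♮‖ ≤ 2‖½(M + Mᴴ)‖ ≤ 2‖M‖`
    have h := hWq Y r' hr' hY1 hY2 b
    have hw3 : 0 ≤ w 3 b := by rw [hw 3 b]; positivity
    calc w 3 b * ‖(1 / 2 : ℝ) • (W₀ Y b + (W₀ Y b)ᴴ) - (Matrix.trace ((1 / 2 : ℝ) • (W₀ Y b + (W₀ Y b)ᴴ)) / 2) • (1 : Matrix (Fin 2) (Fin 2) ℂ)‖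
        ≤ w 3 b * (2 * ‖W₀ Y b‖) := by
          refine mul_le_mul_of_nonneg_left ((norm_sub_halfTrace_le _).trans ?_) hw3
          exact mul_le_mul_of_nonneg_left (norm_hermPart_le (W₀ Y b)) (by norm_num)
      _ = 2 * (w 3 b * ‖W₀ Y b‖) := by ring
      _ ≤ 2 * (C₄ * r' ^ 2) := mul_le_mul_of_nonneg_left h (by norm_num)
      _ = 2 * C₄ * r' ^ 2 := by ring
  · -- the pairing of `(A′, W♮)` against `s•E`, `E` self-adjoint: reduce to the traceless test `E₀ = E − ½(tr E)·1` and the current `W₀`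
    set E₀ : Matrix (Fin 2) (Fin 2) ℂ := E - (Matrix.trace E / 2) • (1 : Matrix (Fin 2) (Fin 2) ℂ) with hE₀
    have hE₀sa : IsSelfAdjoint E₀ := isSelfAdjoint_sub_halfTrace hE
    have hE₀tr : Matrix.trace E₀ = 0 := trace_sub_halfTrace E
    have h := hpair s hs E₀ hE₀sa hE₀tr
    -- split the real part of the pairing (as in `row165_of_tracePairing_L5_anyW`)
    have key : ∀ (X : PBond (PV 2 ℓ m K hd3 hL) 0 → Matrix (Fin 2) (Fin 2) ℂ) (E' : Matrix (Fin 2) (Fin 2) ℂ),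
        (((((((ℓ + 1 : ℕ) : ℝ)⁻¹) ^ (K - n) : ℝ) : ℂ) ^ 2 / 2) *
            ∑ p : Plaq (PV 2 ℓ m K hd3 hL) 0, Matrix.trace ((A' ⟨p.src, p.μ⟩ + A' ⟨p.src.shift p.μ, p.ν⟩ - A' ⟨p.src.shift p.ν, p.μ⟩ - A' ⟨p.src, p.ν⟩) *
              (((s ⟨p.src, p.μ⟩ : ℝ) : ℂ) • E' + ((s ⟨p.src.shift p.μ, p.ν⟩ : ℝ) : ℂ) • E' - ((s ⟨p.src.shift p.ν, p.μ⟩ : ℝ) : ℂ) • E' -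
                ((s ⟨p.src, p.ν⟩ : ℝ) : ℂ) • E')) +
          (((((ℓ + 1 : ℕ) : ℝ)⁻¹) ^ (K - n) : ℝ) : ℂ) ^ 4 * ∑ b : PBond (PV 2 ℓ m K hd3 hL) 0, Matrix.trace (X b * (((s b : ℝ) : ℂ) • E'))).re =
        (((((((ℓ + 1 : ℕ) : ℝ)⁻¹) ^ (K - n) : ℝ) : ℂ) ^ 2 / 2) *
            ∑ p : Plaq (PV 2 ℓ m K hd3 hL) 0, Matrix.trace ((A' ⟨p.src, p.μ⟩ + A' ⟨p.src.shift p.μ, p.ν⟩ - A' ⟨p.src.shift p.ν, p.μ⟩ - A' ⟨p.src, p.ν⟩) *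
              (((s ⟨p.src, p.μ⟩ : ℝ) : ℂ) • E' + ((s ⟨p.src.shift p.μ, p.ν⟩ : ℝ) : ℂ) • E' - ((s ⟨p.src.shift p.ν, p.μ⟩ : ℝ) : ℂ) • E' -
                ((s ⟨p.src, p.ν⟩ : ℝ) : ℂ) • E'))).re +
          ((((ℓ + 1 : ℕ) : ℝ)⁻¹) ^ (K - n)) ^ 4 * ∑ b : PBond (PV 2 ℓ m K hd3 hL) 0, (Matrix.trace (X b * (((s b : ℝ) : ℂ) • E'))).re := by
      intro X E'
      rw [Complex.add_re]
      congr 1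
      rw [Complex.mul_re, ← Complex.ofReal_pow, Complex.ofReal_re, Complex.ofReal_im, zero_mul, sub_zero, Complex.re_sum]
    rw [key] at h ⊢
    -- the test `s•E` against a traceless matrix may be replaced by `s•E₀`
    have htest : ∀ (M : Matrix (Fin 2) (Fin 2) ℂ), Matrix.trace M = 0 → ∀ (a b c d : ℝ),
        Matrix.trace (M * (((a : ℝ) : ℂ) • E + ((b : ℝ) : ℂ) • E - ((c : ℝ) : ℂ) • E - ((d : ℝ) : ℂ) • E)) =
          Matrix.trace (M * (((a : ℝ) : ℂ) • E₀ + ((b : ℝ) : ℂ) • E₀ - ((c : ℝ) : ℂ) • E₀ - ((d : ℝ) : ℂ) • E₀)) := by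
      intro M hM a b c d
      have hsplit : E = E₀ + (Matrix.trace E / 2) • (1 : Matrix (Fin 2) (Fin 2) ℂ) := by rw [hE₀]; abel
      have hcomb : ∀ F : Matrix (Fin 2) (Fin 2) ℂ, ((a : ℝ) : ℂ) • F + ((b : ℝ) : ℂ) • F - ((c : ℝ) : ℂ) • F - ((d : ℝ) : ℂ) • F =
          (((a : ℝ) : ℂ) + ((b : ℝ) : ℂ) - ((c : ℝ) : ℂ) - ((d : ℝ) : ℂ)) • F := by
        intro F; simp only [add_smul, sub_smul]
      rw [hcomb, hcomb]
      conv_lhs => rw [hsplit, smul_add, Matrix.mul_add, Matrix.trace_add, trace_mul_smul_smul_one_eq_zero hM, add_zero]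
    -- plaquette term: `tr Φ_p(A′) = 0`
    have hΦ : ∀ p : Plaq (PV 2 ℓ m K hd3 hL) 0,
        Matrix.trace (A' ⟨p.src, p.μ⟩ + A' ⟨p.src.shift p.μ, p.ν⟩ - A' ⟨p.src.shift p.ν, p.μ⟩ - A' ⟨p.src, p.ν⟩) = 0 := by
      intro p
      rw [Matrix.trace_sub, Matrix.trace_sub, Matrix.trace_add, hA'tr, hA'tr, hA'tr, hA'tr]
      ring
    have hterm1 : ∀ p : Plaq (PV 2 ℓ m K hd3 hL) 0,
        Matrix.trace ((A' ⟨p.src, p.μ⟩ + A' ⟨p.src.shift p.μ, p.ν⟩ - A' ⟨p.src.shift p.ν, p.μ⟩ - A' ⟨p.src, p.ν⟩) *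
          (((s ⟨p.src, p.μ⟩ : ℝ) : ℂ) • E + ((s ⟨p.src.shift p.μ, p.ν⟩ : ℝ) : ℂ) • E - ((s ⟨p.src.shift p.ν, p.μ⟩ : ℝ) : ℂ) • E -
            ((s ⟨p.src, p.ν⟩ : ℝ) : ℂ) • E)) =
        Matrix.trace ((A' ⟨p.src, p.μ⟩ + A' ⟨p.src.shift p.μ, p.ν⟩ - A' ⟨p.src.shift p.ν, p.μ⟩ - A' ⟨p.src, p.ν⟩) *
          (((s ⟨p.src, p.μ⟩ : ℝ) : ℂ) • E₀ + ((s ⟨p.src.shift p.μ, p.ν⟩ : ℝ) : ℂ) • E₀ - ((s ⟨p.src.shift p.ν, p.μ⟩ : ℝ) : ℂ) • E₀ -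
            ((s ⟨p.src, p.ν⟩ : ℝ) : ℂ) • E₀)) := fun p => htest _ (hΦ p) _ _ _ _
    -- bond term: `Re tr(W♮·(sE)) = Re tr(W♮·(sE₀)) = Re tr(½(W+Wᴴ)·(sE₀)) = Re tr(W·(sE₀))`
    have hterm2 : ∀ b : PBond (PV 2 ℓ m K hd3 hL) 0,
        (Matrix.trace (((1 / 2 : ℝ) • (W₀ A' b + (W₀ A' b)ᴴ) - (Matrix.trace ((1 / 2 : ℝ) • (W₀ A' b + (W₀ A' b)ᴴ)) / 2) • (1 : Matrix (Fin 2) (Fin 2) ℂ)) *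
          (((s b : ℝ) : ℂ) • E))).re = (Matrix.trace (W₀ A' b * (((s b : ℝ) : ℂ) • E₀))).re := by
      intro b
      have hsplit : ((s b : ℝ) : ℂ) • E = ((s b : ℝ) : ℂ) • E₀ + ((s b : ℝ) : ℂ) • ((Matrix.trace E / 2) • (1 : Matrix (Fin 2) (Fin 2) ℂ)) := by
        rw [← smul_add, hE₀, sub_add_cancel]
      rw [hsplit, Matrix.mul_add, Matrix.trace_add, trace_mul_smul_smul_one_eq_zero (trace_sub_halfTrace _), add_zero,
        re_trace_sub_halfTrace_mul _ _ hE₀tr, re_trace_mul_eq_hermPart (W₀ A' b) E₀ hE₀sa (s b)]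
    simp only [hterm1, hterm2]
    exact h

end Carrier

end Summit.QuantumFields.YangMills.Theorems.HalvingA1Row165TraceSU2

end
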